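import Literature.NumberTheory.Rogawski1990.ArchInnerTransferCongruence        -- ★ (T-d) FILE 2: `corresponds_archCongr_right_iff`, `isRegularElt_coe_archCongr_iff`, `isStablyConj_archCongr_iff`
import Literature.NumberTheory.Automorphic.ArchCongruenceOrbitalTransport      -- ★ (T-d) FILE 1: `coe_archCongrOfEq_apply`, the quasi-split datum `formCongr_quasiSplitFrame_diagonal`
import Literature.NumberTheory.Automorphic.ArchDiagonalTorus                  -- ★ `archDiagTorus`, `archAt_archDiagTorus`, `coe_archDiagTorus_eq_diagonal`
import Literature.NumberTheory.Automorphic.ArchLocalRegularOrbitClosed         -- ★ `locallyCompactSpace_archLocal`, `secondCountableTopology_archLocal`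
import Literature.NumberTheory.Automorphic.UnitaryGroupArchTopology            -- ★ instances: `arch` locally compact, second countable, T₂
import Mathlib.MeasureTheory.Measure.Haar.Unique
import HarnessLib

/-!
# Haar ∕ torus READING KIT for the (S-d) descent: full-group Haar orbital integrals of `U(H₂)(L ⊗ ℝ)` read on a congruent DIAGONAL carrier as product-torus
# integrals, and correspondences of torus points at equal angles (node N3-b of SdArch ED. 3; Rogawski 1990 §14.4 p. 237 «`f_v = f′_v ∘ ψ_v⁻¹`», §1.7 p. 6)

Topic `NumberTheory/Rogawski1990`; namespace `Literature.NumberTheory.Rogawski1990` (§1 generic under `Literature.MeasureTheory.Group`).  THEOREMS ONLY (kernel lane,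
count-neutral `--supports` H413; no `def`, no instance, no notation, no `sorry`).  Cell `pub/hodgecm-mathlib`, ENGINE T1 (crux H413 = `stmt-HodgeConjecture-24833`); ROAD-Sd
residual R4, SdArch ED. 3 DESIGN (F0P3a-p03 (g11) census 7141d221, LEAD WORD T8-135) node N3 as REDEFINED by the designer 07:41:11Z («the letter applies BY NAME on
`diagonal quasiSplitWeights` (★ `ArchCentralLimitFormulaQuasiSplit`); what must be transported along `Ψ_Q` is the G-side DATA — orbital integrals ∕ central value ∕ `ν`»)
and the N5 census 783c9612 §4 («`ν = κ • e⁻¹_*(⊗ νw)`», «`Θ ∘ ↑↑ = a ∘ Ψ_Q⁻¹` on `arch(diagonal quasiSplitWeights)`», «`A, B` SYSTEM-FREE»); typed by F0P3a-p02 (g11), 2026-09-01.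
Pattern: ★ 3H FILE B `ArchEndoscopicStableSumTorus` §3 (same author) one rank up and without the abelian factor.

WHAT IS PROVED.
§1 GENERIC (any locally compact second countable groups):
  * `exists_integral_comp_conj_eq_mul_integral_comp_of_continuousMulEquiv` — for a group iso `θ : A ≃ₜ* B` and Haar measures `μ` on `A`, `ν` on `B` there is ONE `κ > 0` with
    `∫_B f(h·θx·h⁻¹) dν(h) = κ · ∫_A f(θ(o·x·o⁻¹)) dμ(o)` for EVERY `f : B → ℂ` and EVERY `x : A` (Haar uniqueness `ν = κ • θ_*μ` + change of variables; `κ` depends on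
    `(θ, μ, ν)` only — this is where the «system-free» constants of the N5 interface live).
  * `integral_comp_conj_pi_eq_integral_pi_map_conj` — on a finite product `Π_i G_i`: `∫ f(o·t·o⁻¹) d(⊗ μ_i)(o) = ∫ f d(⊗_i conj(t_i)_* μ_i)` for measurable `f` (Mathlib `Measure.pi_map_pi`;
    the (E2)-style family token `(μ_i).map (fun g => g * t_i * g⁻¹)` at `S = univ`).
§2 THE ARCH FRAME (★ (T-d) style: an abstract `Φ : U(H₂)(L ⊗ ℝ) ≃ₜ* U(diag γ)(L ⊗ ℝ)` acting by `g ↦ T g T⁻¹`; for the quasi-split `G_∞ = U(Φ₃)(L ⊗ ℝ)` take `Φ := Ψ_Q`, `γ := (½, 1, −½)`,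
`T := Q ⊗ 1`, `hΦ := fun _ => rfl` by ★ `coe_archCongrOfEq_apply … (formCongr_quasiSplitFrame_diagonal L)`; for the inner form `G′_∞ = U(diag α)(L ⊗ ℝ)` take `Φ := refl`, `T := 1`):
  * `exists_integral_comp_conj_archCongr_symm_eq_mul_integral_pi` — ONE `κ > 0` (per `(Φ, ν, νw)`) with
    `∫_{U(H₂)} f(h · Φ⁻¹(e⁻¹ t) · h⁻¹) dν(h) = κ · ∫_{Π_w U(σ_w diag γ)(ℂ)} f(Φ⁻¹(e⁻¹(o·t·o⁻¹))) d(⊗_w ν_w)(o)` for every `f` and every `t = (t_w)_w`, `e = archPiEquivCM` — the G-side Haar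
    orbital integral READ ON THE DIAGONAL CARRIER; and its family form `… = κ · ∫ (f ∘ Φ⁻¹ ∘ e⁻¹) d(⊗_w conj(t_w)_* ν_w)` for measurable `f` (`exists_integral_comp_conj_archCongr_symm_eq_mul_integral_pi_map_conj`).
  * `archCongr_symm_archPiEquivCM_symm_circleDiagonal` — the torus point: `Φ⁻¹(e⁻¹ (diag z_w)_w) = Φ⁻¹(t(z))` (★ `archAt_archDiagTorus`).
  * `corresponds_archDiagTorus_archDiagTorus` — `t_α(z) ↔ t_γ(z)`: torus points with the SAME angles on two diagonal carriers correspond (they are the same matrix of `GL₃(L ⊗ ℝ)`);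
    `corresponds_archDiagTorus_archCongr_symm_archDiagTorus` — hence `t_α(z) ↔ Φ⁻¹(t_γ(z))` (★ `corresponds_archCongr_right_iff`): the `γ′ ↔ δ` input of ★ FILE 2 §3
    `archStableOrbitalIntegral_transport_eq_of_isArchInnerTransfer` at the torus points the descent moves.
  * `isRegularElt_coe_archCongr_symm_iff` — regularity is read through `Φ⁻¹` (★ `isRegularElt_coe_archCongr_iff`).
NOT here (stays with N4 «E1-inner»): the stable-CLASS-SET ↔ Weyl-label bookkeeping (★ (V8) `conjClasses_stable_archDiagTorus_eq_range_of_conj` + ★ `isStablyConj_archCongr_iff`) and the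
Weil-quotient masses (★ (E1) §1); the central VALUE through `Φ⁻¹` is ★ `archCongr_symm_cmRationalToArch_of_smul_one` (F0P3-p03 (g9)), cited not restated.
HONEST LABEL: HC_CM is proved only modulo the printed citations until rung 0 closes; this file is measure bookkeeping and pays nothing by itself.

## References
* [Rogawski1990] J. D. Rogawski, *Automorphic Representations of Unitary Groups in Three Variables* (1990), §1.7 p. 6 (compatible measures), §14.1 p. 232 (`Φ₃`, correspondences),
  §14.4 p. 237 («`f_v = f′_v ∘ ψ_v⁻¹`»), §14.5 p. 239 ((S-d)).
* [DeitmarEchterhoff2014] A. Deitmar, S. Echterhoff, *Principles of Harmonic Analysis*, 2nd ed. (2014), Thm. 1.5.3 (uniqueness of Haar measure).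
* [Folland1995] G. B. Folland, *A Course in Abstract Harmonic Analysis* (1995), §2.6 (2.52) (change of variables along a group isomorphism).
-/

open MeasureTheory Measure NumberField NumberField.InfinitePlace NumberField.mixedEmbedding
open scoped NNReal Classical

/-! ## §1 Generic readings -/

namespace Literature.MeasureTheory.Group

section Iso

variable {A B : Type*} [Group A] [TopologicalSpace A] [IsTopologicalGroup A] [MeasurableSpace A] [BorelSpace A]
  [Group B] [TopologicalSpace B] [IsTopologicalGroup B] [LocallyCompactSpace B] [SecondCountableTopology B] [MeasurableSpace B] [BorelSpace B]

/-- **HAAR ORBITAL INTEGRALS READ ALONG A GROUP ISOMORPHISM, ONE CONSTANT FOR ALL TEST FUNCTIONS AND ALL POINTS**: for `θ : A ≃ₜ* B` and Haar measures `μ` on `A`, `ν` on `B`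
there is `κ > 0` with `∫_B f(h·θx·h⁻¹) dν(h) = κ · ∫_A f(θ(o·x·o⁻¹)) dμ(o)` for every `f : B → ℂ` and every `x ∈ A` (`ν = κ • θ_*μ` by uniqueness of Haar measure, then the change of
variables `h = θ o`; both sides use the same junk value for non-integrable `f`). [cite: DeitmarEchterhoff2014, Thm. 1.5.3] [cite: Folland1995, §2.6 (2.52)] [cite: Rogawski1990, §1.7 p. 6] -/
theorem exists_integral_comp_conj_eq_mul_integral_comp_of_continuousMulEquiv (θ : A ≃ₜ* B) (μ : Measure A) [μ.IsHaarMeasure] (ν : Measure B) [ν.IsHaarMeasure] :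
    ∃ κ : ℝ, 0 < κ ∧ ∀ (f : B → ℂ) (x : A), ∫ h, f (h * θ x * h⁻¹) ∂ν = (κ : ℂ) * ∫ o, f (θ (o * x * o⁻¹)) ∂μ := by
  set φ := θ.toHomeomorph.toMeasurableEquiv with hφ
  have hφθ : (⇑φ : A → B) = ⇑θ := rfl
  set ρ : Measure B := μ.map φ with hρ
  haveI : ρ.IsHaarMeasure := by
    rw [hρ, hφθ]
    exact ContinuousMulEquiv.isHaarMeasure_map μ θ
  have hint : ∀ F : B → ℂ, ∫ h, F h ∂ρ = ∫ o, F (θ o) ∂μ := fun F => by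
    rw [hρ]
    exact integral_map_equiv φ F
  have hν : ν = haarScalarFactor ν ρ • ρ := isMulLeftInvariant_eq_smul ν ρ
  have hc : 0 < haarScalarFactor ν ρ := haarScalarFactor_pos_of_isHaarMeasure ν ρ
  refine ⟨haarScalarFactor ν ρ, NNReal.coe_pos.2 hc, fun f x => ?_⟩
  have hpt : ∀ o : A, θ o * θ x * (θ o)⁻¹ = θ (o * x * o⁻¹) := fun o => by
    rw [map_mul, map_mul, map_inv]
  calc ∫ h, f (h * θ x * h⁻¹) ∂ν
      = ∫ h, f (h * θ x * h⁻¹) ∂(haarScalarFactor ν ρ • ρ) := by rw [← hν]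
    _ = haarScalarFactor ν ρ • ∫ o, f (θ o * θ x * (θ o)⁻¹) ∂μ := by
        rw [integral_smul_nnreal_measure, hint]
    _ = haarScalarFactor ν ρ • ∫ o, f (θ (o * x * o⁻¹)) ∂μ := by simp only [hpt]
    _ = ((haarScalarFactor ν ρ : ℝ) : ℂ) * ∫ o, f (θ (o * x * o⁻¹)) ∂μ := by
        rw [NNReal.smul_def, Complex.real_smul]

end Iso

section Pi

variable {ι : Type*} [Fintype ι] {G : ι → Type*} [∀ i, Group (G i)] [∀ i, TopologicalSpace (G i)] [∀ i, IsTopologicalGroup (G i)]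
  [∀ i, MeasurableSpace (G i)] [∀ i, BorelSpace (G i)]

/-- **PRODUCT-TORUS READING**: on a finite product of topological groups, conjugating coordinatewise by `t = (t_i)` under the product measure is integrating against the product of
the push-forwards `conj(t_i)_* μ_i` — the (E2)-style measure family at `S = univ`: `∫ f(o·t·o⁻¹) d(⊗ μ_i)(o) = ∫ f d(⊗_i (μ_i).map (g ↦ g t_i g⁻¹))` for measurable `f`.
[cite: DeitmarEchterhoff2014, Thm. 1.5.3] [cite: Rogawski1990, §4.9 p. 54] -/
theorem integral_comp_conj_pi_eq_integral_pi_map_conj (μ : ∀ i, Measure (G i)) [∀ i, SigmaFinite (μ i)] (t : ∀ i, G i)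
    [∀ i, SigmaFinite ((μ i).map (fun g : G i => g * t i * g⁻¹))] {f : (∀ i, G i) → ℂ} (hf : Measurable f) :
    ∫ o, f (o * t * o⁻¹) ∂(Measure.pi μ) = ∫ y, f y ∂(Measure.pi fun i => (μ i).map (fun g : G i => g * t i * g⁻¹)) := by
  have hmeas : ∀ i, Measurable (fun g : G i => g * t i * g⁻¹) := fun i =>
    ((continuous_id.mul continuous_const).mul continuous_id.inv).measurable
  have hpi : (Measure.pi μ).map (fun (o : ∀ i, G i) (i : ι) => (fun g : G i => g * t i * g⁻¹) (o i)) =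
      Measure.pi fun i => (μ i).map (fun g : G i => g * t i * g⁻¹) :=
    Measure.pi_map_pi (fun i => (hmeas i).aemeasurable)
  have hconj : (fun o : ∀ i, G i => o * t * o⁻¹) = fun (o : ∀ i, G i) (i : ι) => (fun g : G i => g * t i * g⁻¹) (o i) := by
    funext o i
    rfl
  have hm : Measurable (fun o : ∀ i, G i => o * t * o⁻¹) := by
    rw [hconj]
    exact measurable_pi_lambda _ fun i => (hmeas i).comp (measurable_pi_apply i)
  rw [← hpi, ← hconj, integral_map hm.aemeasurable hf.aestronglyMeasurable]

end Pi

end Literature.MeasureTheory.Group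

/-! ## §2 The arch frame: `U(H₂)(L ⊗ ℝ)` read on a congruent diagonal carrier `U(diag γ)(L ⊗ ℝ) ≅ Π_w U(σ_w diag γ)(ℂ)` -/

namespace Literature.NumberTheory.Rogawski1990

open Literature.MeasureTheory.Group Literature.NumberTheory.Automorphic Literature.NumberTheory.Automorphic.UnitaryGroup

section Frame

variable (L : Type) [Field L] [NumberField L] [IsCMField L] {N : ℕ} {H₂ : Matrix (Fin N) (Fin N) L} (γ : Fin N → L) (T : GL (Fin N) (mixedSpace L))
  (Φ : UnitaryGroup.arch (↥(maximalRealSubfield L)) L (IsCMField.complexConj L) N H₂ ≃ₜ*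
    UnitaryGroup.arch (↥(maximalRealSubfield L)) L (IsCMField.complexConj L) N (Matrix.diagonal γ))
  (hΦ : ∀ g : UnitaryGroup.arch (↥(maximalRealSubfield L)) L (IsCMField.complexConj L) N H₂,
    ((Φ g : UnitaryGroup.arch (↥(maximalRealSubfield L)) L (IsCMField.complexConj L) N (Matrix.diagonal γ)) : GL (Fin N) (mixedSpace L)) =
      T * (g : GL (Fin N) (mixedSpace L)) * T⁻¹)

/-- **THE G-SIDE HAAR ORBITAL INTEGRAL READ ON THE DIAGONAL CARRIER** (pattern ★ 3H FILE B §3, no abelian factor): for a Haar measure `ν` on `U(H₂)(L ⊗ ℝ)` and per-place Haar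
measures `ν_w` on `U(σ_w diag γ)(ℂ)` there is ONE `κ > 0` such that for EVERY `f` and EVERY `t = (t_w)_w`,
`∫_{U(H₂)} f(h · Φ⁻¹(e⁻¹ t) · h⁻¹) dν(h) = κ · ∫_{Π_w U(σ_w diag γ)(ℂ)} f(Φ⁻¹(e⁻¹(o·t·o⁻¹))) d(⊗_w ν_w)(o)`, `e = archPiEquivCM` — §1 at `θ := e⁻¹ ≫ Φ⁻¹` and `μ := ⊗_w ν_w` (a Haar
measure on the product).  For `Φ := Ψ_Q` this is the census's «`ν = κ • e⁻¹_*(⊗ νw)`» reading of the quasi-split side; for `Φ := refl` the inner-form side.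
[cite: Rogawski1990, §14.4 p. 237; §1.7 p. 6] [cite: DeitmarEchterhoff2014, Thm. 1.5.3] -/
theorem exists_integral_comp_conj_archCongr_symm_eq_mul_integral_pi
    [MeasurableSpace (UnitaryGroup.arch (↥(maximalRealSubfield L)) L (IsCMField.complexConj L) N H₂)]
    [BorelSpace (UnitaryGroup.arch (↥(maximalRealSubfield L)) L (IsCMField.complexConj L) N H₂)]
    [∀ w : {w : InfinitePlace L // IsComplex w}, MeasurableSpace (archLocal L N (Matrix.diagonal γ) w)]
    [∀ w : {w : InfinitePlace L // IsComplex w}, BorelSpace (archLocal L N (Matrix.diagonal γ) w)]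
    (ν : Measure (UnitaryGroup.arch (↥(maximalRealSubfield L)) L (IsCMField.complexConj L) N H₂)) [ν.IsHaarMeasure]
    (νw : ∀ w : {w : InfinitePlace L // IsComplex w}, Measure (archLocal L N (Matrix.diagonal γ) w)) [∀ w, (νw w).IsHaarMeasure] :
    ∃ κ : ℝ, 0 < κ ∧
      ∀ (f : UnitaryGroup.arch (↥(maximalRealSubfield L)) L (IsCMField.complexConj L) N H₂ → ℂ)
        (t : ∀ w : {w : InfinitePlace L // IsComplex w}, archLocal L N (Matrix.diagonal γ) w),
        ∫ h, f (h * Φ.symm ((archPiEquivCM N L (Matrix.diagonal γ)).symm t) * h⁻¹) ∂ν =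
          (κ : ℂ) * ∫ o, f (Φ.symm ((archPiEquivCM N L (Matrix.diagonal γ)).symm (o * t * o⁻¹))) ∂(Measure.pi νw) := by
  haveI : ∀ w : {w : InfinitePlace L // IsComplex w}, SecondCountableTopology (archLocal L N (Matrix.diagonal γ) w) :=
    fun w => secondCountableTopology_archLocal L N (Matrix.diagonal γ) w
  haveI : ∀ w : {w : InfinitePlace L // IsComplex w}, LocallyCompactSpace (archLocal L N (Matrix.diagonal γ) w) :=
    fun w => locallyCompactSpace_archLocal L N (Matrix.diagonal γ) w
  haveI : (Measure.pi νw).IsHaarMeasure := inferInstance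
  obtain ⟨κ, hκ, h⟩ := exists_integral_comp_conj_eq_mul_integral_comp_of_continuousMulEquiv
    (((archPiEquivCM N L (Matrix.diagonal γ)).symm).trans Φ.symm) (Measure.pi νw) ν
  exact ⟨κ, hκ, fun f t => h f t⟩

/-- **… IN FAMILY FORM** (the (E2)-style token at `S = univ`): for measurable `f`,
`∫_{U(H₂)} f(h · Φ⁻¹(e⁻¹ t) · h⁻¹) dν(h) = κ · ∫ (f ∘ Φ⁻¹ ∘ e⁻¹) d(⊗_w conj(t_w)_* ν_w)` with the SAME `κ` for all `f`, `t` (§1 `integral_comp_conj_pi_eq_integral_pi_map_conj`; the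
σ-finiteness of the orbit push-forwards is the caller's — automatic at regular elliptic torus points, ★ (E2) family lemmas). [cite: Rogawski1990, §14.4 p. 237; §4.9 p. 54] -/
theorem exists_integral_comp_conj_archCongr_symm_eq_mul_integral_pi_map_conj
    [MeasurableSpace (UnitaryGroup.arch (↥(maximalRealSubfield L)) L (IsCMField.complexConj L) N H₂)]
    [BorelSpace (UnitaryGroup.arch (↥(maximalRealSubfield L)) L (IsCMField.complexConj L) N H₂)]
    [∀ w : {w : InfinitePlace L // IsComplex w}, MeasurableSpace (archLocal L N (Matrix.diagonal γ) w)]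
    [∀ w : {w : InfinitePlace L // IsComplex w}, BorelSpace (archLocal L N (Matrix.diagonal γ) w)]
    (ν : Measure (UnitaryGroup.arch (↥(maximalRealSubfield L)) L (IsCMField.complexConj L) N H₂)) [ν.IsHaarMeasure]
    (νw : ∀ w : {w : InfinitePlace L // IsComplex w}, Measure (archLocal L N (Matrix.diagonal γ) w)) [∀ w, (νw w).IsHaarMeasure] :
    ∃ κ : ℝ, 0 < κ ∧
      ∀ (f : UnitaryGroup.arch (↥(maximalRealSubfield L)) L (IsCMField.complexConj L) N H₂ → ℂ), Measurable f →
        ∀ (t : ∀ w : {w : InfinitePlace L // IsComplex w}, archLocal L N (Matrix.diagonal γ) w)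
          [∀ w, SigmaFinite ((νw w).map (fun g : archLocal L N (Matrix.diagonal γ) w => g * t w * g⁻¹))],
        ∫ h, f (h * Φ.symm ((archPiEquivCM N L (Matrix.diagonal γ)).symm t) * h⁻¹) ∂ν =
          (κ : ℂ) * ∫ o, f (Φ.symm ((archPiEquivCM N L (Matrix.diagonal γ)).symm o))
            ∂(Measure.pi fun w => (νw w).map (fun g : archLocal L N (Matrix.diagonal γ) w => g * t w * g⁻¹)) := by
  haveI : ∀ w : {w : InfinitePlace L // IsComplex w}, SecondCountableTopology (archLocal L N (Matrix.diagonal γ) w) :=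
    fun w => secondCountableTopology_archLocal L N (Matrix.diagonal γ) w
  haveI : ∀ w : {w : InfinitePlace L // IsComplex w}, LocallyCompactSpace (archLocal L N (Matrix.diagonal γ) w) :=
    fun w => locallyCompactSpace_archLocal L N (Matrix.diagonal γ) w
  obtain ⟨κ, hκ, h⟩ := exists_integral_comp_conj_archCongr_symm_eq_mul_integral_pi L γ Φ ν νw
  refine ⟨κ, hκ, fun f hf t _ => ?_⟩
  have hmeas : Measurable fun o : (∀ w : {w : InfinitePlace L // IsComplex w}, archLocal L N (Matrix.diagonal γ) w) =>
      f (Φ.symm ((archPiEquivCM N L (Matrix.diagonal γ)).symm o)) :=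
    hf.comp ((Φ.symm.continuous.comp (archPiEquivCM N L (Matrix.diagonal γ)).symm.continuous).measurable)
  rw [h f t, ← integral_comp_conj_pi_eq_integral_pi_map_conj νw t hmeas]

/-- **THE TORUS POINT**: `Φ⁻¹(e⁻¹ (diag z_w)_w) = Φ⁻¹(t(z))` with `t = archDiagTorus` (★ `archAt_archDiagTorus`) — the shape in which the readings above are applied at the
circle-torus points the descent moves. [cite: Rogawski1990, §8.4 p. 126; §4.9 p. 54] -/
theorem archCongr_symm_archPiEquivCM_symm_circleDiagonal (z : {w : InfinitePlace L // IsComplex w} → Fin N → Circle) :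
    Φ.symm ((archPiEquivCM N L (Matrix.diagonal γ)).symm
        (fun w => (⟨circleDiagonal N (z w), circleDiagonal_mem_archLocal_diagonal L N γ w (z w)⟩ : archLocal L N (Matrix.diagonal γ) w))) =
      Φ.symm (archDiagTorus L N γ z) := by
  exact congrArg Φ.symm ((ContinuousMulEquiv.symm_apply_eq _).2 (funext fun w => (Subtype.ext (archAt_archDiagTorus L N γ z w)).symm))

/-- **TORUS POINTS WITH THE SAME ANGLES ON TWO DIAGONAL CARRIERS CORRESPOND**: `t_α(z) ↔ t_γ(z)` — both are the diagonal matrix `diag((z_{w,i})_w)_i` of `GL_N(L ⊗ ℝ)` (★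
`coe_archDiagTorus_eq_diagonal`), so the conjugator is `1`. [cite: Rogawski1990, §14.1 p. 232; §3.1 p. 19] -/
theorem corresponds_archDiagTorus_archDiagTorus (α : Fin N → L) (z : {w : InfinitePlace L // IsComplex w} → Fin N → Circle) :
    Corresponds (UnitaryGroup.conjMixed (↥(maximalRealSubfield L)) L (IsCMField.complexConj L)) (UnitaryGroup.archFormOf L N (Matrix.diagonal α))
      (UnitaryGroup.archFormOf L N (Matrix.diagonal γ)) (archDiagTorus L N α z) (archDiagTorus L N γ z) := by
  have h : ((archDiagTorus L N α z : UnitaryGroup.arch (↥(maximalRealSubfield L)) L (IsCMField.complexConj L) N (Matrix.diagonal α)) : GL (Fin N) (mixedSpace L)) =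
      ((archDiagTorus L N γ z : UnitaryGroup.arch (↥(maximalRealSubfield L)) L (IsCMField.complexConj L) N (Matrix.diagonal γ)) : GL (Fin N) (mixedSpace L)) :=
    Units.ext (by rw [coe_archDiagTorus_eq_diagonal, coe_archDiagTorus_eq_diagonal])
  show IsConj _ _
  rw [h]

include hΦ in
/-- **… HENCE `t_α(z) ↔ Φ⁻¹(t_γ(z))`** for every congruence `Φ : U(H₂) ≃ U(diag γ)`, `g ↦ T g T⁻¹` (★ `corresponds_archCongr_right_iff`): the `γ′ ↔ δ` input of ★ FILE 2 §3
`archStableOrbitalIntegral_transport_eq_of_isArchInnerTransfer` ∕ of (14.2.1) at the torus points of the (S-d) descent (`α` = the inner form's diagonal, `H₂ = Φ₃`, `Φ = Ψ_Q`).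
[cite: Rogawski1990, §14.1 p. 232; §14.2 (14.2.1) p. 232] -/
theorem corresponds_archDiagTorus_archCongr_symm_archDiagTorus (α : Fin N → L) (z : {w : InfinitePlace L // IsComplex w} → Fin N → Circle) :
    Corresponds (UnitaryGroup.conjMixed (↥(maximalRealSubfield L)) L (IsCMField.complexConj L)) (UnitaryGroup.archFormOf L N (Matrix.diagonal α))
      (UnitaryGroup.archFormOf L N H₂) (archDiagTorus L N α z) (Φ.symm (archDiagTorus L N γ z)) := by
  rw [← corresponds_archCongr_right_iff L T Φ hΦ (archDiagTorus L N α z) (Φ.symm (archDiagTorus L N γ z)), ContinuousMulEquiv.apply_symm_apply]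
  exact corresponds_archDiagTorus_archDiagTorus L γ α z

include hΦ in
/-- **REGULARITY IS READ THROUGH `Φ⁻¹`**: `Φ⁻¹ x` is regular iff `x` is (★ `isRegularElt_coe_archCongr_iff` at `g := Φ⁻¹ x`). [cite: Rogawski1990, §14.1 p. 232] -/
theorem isRegularElt_coe_archCongr_symm_iff (x : UnitaryGroup.arch (↥(maximalRealSubfield L)) L (IsCMField.complexConj L) N (Matrix.diagonal γ)) :
    IsRegularElt ((Φ.symm x : UnitaryGroup.arch (↥(maximalRealSubfield L)) L (IsCMField.complexConj L) N H₂) : GL (Fin N) (mixedSpace L)) ↔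
      IsRegularElt (x : GL (Fin N) (mixedSpace L)) := by
  rw [← isRegularElt_coe_archCongr_iff L T Φ hΦ (Φ.symm x), ContinuousMulEquiv.apply_symm_apply]

end Frame

/-! ## §3 The quasi-split instance: `Ψ_Q : U(Φ₃)(L ⊗ ℝ) ≃ₜ* U(diag(½, 1, −½))(L ⊗ ℝ)`, `g ↦ (Q ⊗ 1) g (Q ⊗ 1)⁻¹` -/

section QuasiSplit

variable (L : Type) [Field L] [NumberField L] [IsCMField L]

/-- The `hΦ` of §2 for `Φ := Ψ_Q` — the TERM ★ `unitaryGroupOfFormCongrOfEq … (formCongr_map_mixedEmbedding_archFormOf_eq L (formCongr_quasiSplitFrame_diagonal L))` — holds by `rfl`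
(★ `coe_archCongrOfEq_apply`); recorded at the literal antidiagonal `Φ₃` so the N4 ∕ N6 files cite one name. [cite: Rogawski1990, §14.1 p. 232] [cite: PlatonovRapinchuk1994, §2.3] -/
theorem coe_archCongrOfEq_quasiSplit_apply
    (g : UnitaryGroup.arch (↥(maximalRealSubfield L)) L (IsCMField.complexConj L) 3 (Matrix.of fun i j : Fin 3 => if i.val + j.val + 1 = 3 then (1 : L) else 0)) :
    ((unitaryGroupOfFormCongrOfEq (UnitaryGroup.conjMixed (↥(maximalRealSubfield L)) L (IsCMField.complexConj L))
          (Matrix.GeneralLinearGroup.map (mixedEmbedding L)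
            (Matrix.GeneralLinearGroup.mkOfDetNeZero !![(1 : L), 0, 1; 0, 1, 0; 1, 0, -1] (det_quasiSplitFrame_ne_zero L)))
          (UnitaryGroup.archFormOf L 3 (Matrix.diagonal ![(2 : L)⁻¹, 1, -(2 : L)⁻¹]))
          (UnitaryGroup.archFormOf L 3 (Matrix.of fun i j : Fin 3 => if i.val + j.val + 1 = 3 then (1 : L) else 0))
          (formCongr_map_mixedEmbedding_archFormOf_eq L (formCongr_quasiSplitFrame_diagonal L)) g :
        UnitaryGroup.arch (↥(maximalRealSubfield L)) L (IsCMField.complexConj L) 3 (Matrix.diagonal ![(2 : L)⁻¹, 1, -(2 : L)⁻¹])) : GL (Fin 3) (mixedSpace L)) =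
      Matrix.GeneralLinearGroup.map (mixedEmbedding L)
          (Matrix.GeneralLinearGroup.mkOfDetNeZero !![(1 : L), 0, 1; 0, 1, 0; 1, 0, -1] (det_quasiSplitFrame_ne_zero L)) *
        (g : GL (Fin 3) (mixedSpace L)) *
        (Matrix.GeneralLinearGroup.map (mixedEmbedding L)
          (Matrix.GeneralLinearGroup.mkOfDetNeZero !![(1 : L), 0, 1; 0, 1, 0; 1, 0, -1] (det_quasiSplitFrame_ne_zero L)))⁻¹ :=
  coe_archCongrOfEq_apply L (formCongr_quasiSplitFrame_diagonal L) g

end QuasiSplit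

end Literature.NumberTheory.Rogawski1990
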